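import Literature.Computability.QuantumComplexity.PostBQPSubsetPP
import Literature.Computability.QuantumComplexity.PPPostBQPAssembly
import HarnessLib

/-!
# `PostBQP = PP` (Aaronson's theorem): discharge of `PostBQP_eq_PP`

Topic `Literature/Computability/Cryptography`; sibling proof file of `Postselection.lean` (D-0014).
It discharges the named fact `Literature.Computability.Cryptography.PostBQP_eq_PP`
(`PostBQP_eq_PP_holds`): post-selected bounded-error quantum polynomial time (Aaronson's Def. 1,
the tree's `PostBQP` over the gate set Clifford+T, `Postselection.lean`) equals Gill's
probabilistic polynomial time `PP` — S. Aaronson, Proc. R. Soc. A 461 (2005) 3473–3482, Thm. 4 in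
the numbering of arXiv:quant-ph/0412187: Def. 1 `PostBQP`, Prop. 2 `PostBQP ⊆ PP`, Prop. 3
closure properties, Thm. 4 `PostBQP = PP` (the fact's own docstring writes "Thm. 2" for the same
statement) — together with its definitionally equal restatement
`Literature.Computability.QuantumComplexity.PostBQP_eq_PP` (`quantum-advantage.S16`,
`CountingSimulation.lean`).

Both inclusions are theorems of the tree, and this file only assembles them:

* `PostBQP ⊆ PP` (Aaronson 2005, Prop. 2: the Adleman–DeMarrais–Huang path-sum ledger, with an
  exact sign test for the `ℤ[√2]`-valued Clifford+T probabilities) is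
  `QuantumComplexity.PostBQP_subset_PP` (`PostBQPSubsetPP.lean`, on `PostBQPPathSums.lean` and
  `PostBQPMachine.lean`), packaged as the reduction
  `QuantumComplexity.PostBQP_eq_PP_of : PP ⊆ PostBQP → Cryptography.PostBQP_eq_PP`;
* `PP ⊆ PostBQP` (Aaronson 2005, Thm. 4, proof: the post-selected counting algorithm) is
  `QuantumComplexity.PPPostBQP.PP_subset_PostBQP` (`PPPostBQPAssembly.lean`, last of the series
  `PPPostBQPScales.lean` … `PPPostBQPAssembly.lean`).

## References

* S. Aaronson, *Quantum computing, postselection, and probabilistic polynomial-time*, Proc. R.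
  Soc. A 461 (2005) 3473–3482, doi:10.1098/rspa.2005.1546, arXiv:quant-ph/0412187: Def. 1
  (`PostBQP`), Prop. 2 (`PostBQP ⊆ PP`), Thm. 4 (`PostBQP = PP`; proof of `PP ⊆ PostBQP` in §3).
* L. M. Adleman, J. DeMarrais, M.-D. A. Huang, *Quantum computability*, SIAM J. Comput. 26 (1997)
  1524–1540 (`BQP ⊆ PP` by path sums).
* J. Gill, *Computational complexity of probabilistic Turing machines*, SIAM J. Comput. 6 (1977)
  675–695 (`PP`).
-/

namespace Literature.Computability.Cryptography

/-- **Aaronson's theorem** `PostBQP = PP`: discharge of the named fact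
`Literature.Computability.Cryptography.PostBQP_eq_PP` from the two proved inclusions
`QuantumComplexity.PostBQP_subset_PP` (Prop. 2) and `QuantumComplexity.PPPostBQP.PP_subset_PostBQP`
(Thm. 4, proof); numbering of arXiv:quant-ph/0412187. [cite: Aaronson2005, Prop. 2 and Thm. 4] -/
theorem PostBQP_eq_PP_holds : PostBQP_eq_PP :=
  _root_.Literature.Computability.QuantumComplexity.PostBQP_eq_PP_of
    _root_.Literature.Computability.QuantumComplexity.PPPostBQP.PP_subset_PostBQP

end Literature.Computability.Cryptography

namespace Literature.Computability.QuantumComplexity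

/-- **Aaronson's theorem** `PostBQP = PP`, restated target `quantum-advantage.S16`: discharge of
the named fact `Literature.Computability.QuantumComplexity.PostBQP_eq_PP` (definitionally the
statement of `Cryptography.PostBQP_eq_PP`) from `PostBQP_subset_PP` and
`PPPostBQP.PP_subset_PostBQP`; numbering of arXiv:quant-ph/0412187. [cite: Aaronson2005, Prop. 2 and Thm. 4] -/
theorem PostBQP_eq_PP_holds : _root_.Literature.Computability.QuantumComplexity.PostBQP_eq_PP :=
  PostBQP_eq_PP_of' PPPostBQP.PP_subset_PostBQP

/-- The two classes coincide as sets of languages (the content of both named facts, for direct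
use by `rw`). [cite: Aaronson2005, Thm. 4] -/
theorem PostBQP_eq_PP_eq : Cryptography.PostBQP = Complexity.PP :=
  Cryptography.PostBQP_eq_PP_holds

end Literature.Computability.QuantumComplexity
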